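import Literature.NumberTheory.EllipticCurves.CongruentNumberCurve29274Rank
import Mathlib.Tactic.NormNum.LegendreSymbol
import HarnessLib

/-!
# Wiman's congruent number curve `E₂₉₂₇₄`: the complete `2`-descent is sharp — rank exactly `4`

Sequel to `CongruentNumberCurve29274Rank.lean` (`4 ≤ rank_ℤ E₂₉₂₇₄(ℚ)` from Wiman's four
points). Here the UPPER bound: for `E = E₂₉₂₇₄ : y² = x³ - 29274²x = (x + n) x (x - n)`,
`n = 29274 = 2·3·7·17·41`, the complete `2`-descent over `ℚ` (Silverman, *AEC*, Prop. X.1.4 /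
Example X.1.5) in the linear format of `TwoDescentLinearConditions.lean` gives
`rank_ℤ E(ℚ) ≤ 4`, hence **`rank_ℤ E₂₉₂₇₄(ℚ) = 4`** (`mordellWeilRank_eq`) — the census attribute
«Mordell–Weil rank `4` EXACT» of the object c1:G-RN-09 of the Goldfeld census (Goldfeld 1976,
p. 626, of Wiman's example: «has rank `4`» [sic: for the emended curve, ruling G-8]; PARI
`ellrank` `[4, 4]`; robin-lead gen7's stdlib computation `dim Sel₂(E/ℚ) = 6`, RQ-SEL2-29274.md)
as a kernel theorem:

* `φ` — the eleven sign/valuation-parity coordinates of `δ(P) = (x + n, x) ∈ (ℚ*/ℚ*²)²`: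
  `(v₂, v₃, v₇, v₁₇, v₄₁)(x + n)` and `(sign, v₂, v₃, v₇, v₁₇, v₄₁)(x)` mod `2` (the sign of
  `x + n` is `+`, `-n` being the smallest root); `φ` detects the descent class (`hker`);
* the local conditions at `p = 3`, `p = 7` (type `I₀*`, two linear functionals each) and at
  `p = 17` (one is used), from the tree's `local_condition_I0` made linear by
  `qrBit_eq_signBit_add_listSum` and the Legendre symbols `(q/p)`, `q ∈ {-1, 2, 3, 7, 17, 41}`
  (`norm_num`); assembled into `κ ∘ φ = 0` (`kill`) for an explicit surjective
  `κ : (ℤ/2)¹¹ → (ℤ/2)⁵`, the finite implications being checked by `decide`; whence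
  `rank ≤ 11 - 5 - 2 = 4` (`mordellWeilRank_le_of_linear_conditions`). Neither the `2`-adic
  condition nor the one at `41` is needed (they lie in the span of the five used).

The functionals were found outside Lean (robin-lead gen7, RQ-SEL2-29274.md §R-Q.3, and an
independent enumeration by this seat); every claim is re-verified by the kernel. No named facts.

## References

* [SilvermanAEC2009] J. H. Silverman, *The Arithmetic of Elliptic Curves*, 2nd ed., GTM 106,
  Prop. X.1.4 (complete `2`-descent), Example X.1.5.
* [Goldfeld1976] D. Goldfeld, Ann. Sc. Norm. Sup. Pisa (4) 3 (1976) 623–663, p. 626.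
-/

noncomputable section

namespace Literature.NumberTheory.EllipticCurves.CongruentNumber29274

open _root_.WeierstrassCurve _root_.WeierstrassCurve.Affine _root_.WeierstrassCurve.Affine.Point
open Literature.NumberTheory.EllipticCurves.KramerTwoDescent
open Literature.NumberTheory.EllipticCurves.TwoDescentLocal
open Literature.Barriers.BirchSwinnertonDyer.DokchitserDokchitser2011

/-- Rational `2`-torsion abscissae `-29274, 0, 29274`. [folklore] -/
private theorem hsplit : (E).toAffine.SplitTwoTorsion (-29274) 0 29274 := by
  have h := splitTwoTorsion_cn 29274
  norm_num at h
  exact h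

section Descent

/-- The eleven sign/parity coordinates of the complete `2`-descent of `E₂₉₂₇₄`:
`(v₂, v₃, v₇, v₁₇, v₄₁)(x + 29274)` and `(sign, v₂, v₃, v₇, v₁₇, v₄₁)(x)`, mod `2`
(Silverman AEC Prop. X.1.4). [folklore] -/
def φ : (E).toAffine.Point →+ (Fin 11 → ZMod 2) :=
  AddMonoidHom.pi fun i => (![charFst hsplit (parityHom 2), charFst hsplit (parityHom 3),
    charFst hsplit (parityHom 7), charFst hsplit (parityHom 17), charFst hsplit (parityHom 41),
    charSnd hsplit signHom, charSnd hsplit (parityHom 2), charSnd hsplit (parityHom 3),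
    charSnd hsplit (parityHom 7), charSnd hsplit (parityHom 17), charSnd hsplit (parityHom 41)] :
      Fin 11 → ((E).toAffine.Point →+ ZMod 2)) i

/-- `φ` on an affine point off the `2`-torsion. [folklore] -/
private theorem φ_some {x y : ℚ} (hP : (E).toAffine.Nonsingular x y) (hx₁ : x ≠ -29274)
    (hx₂ : x ≠ 0) :
    φ (.some x y hP) = ![parityBit 2 (x - -29274), parityBit 3 (x - -29274),
      parityBit 7 (x - -29274), parityBit 17 (x - -29274), parityBit 41 (x - -29274),
      signBit (x - 0), parityBit 2 (x - 0), parityBit 3 (x - 0), parityBit 7 (x - 0),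
      parityBit 17 (x - 0), parityBit 41 (x - 0)] := by
  have hx₁' : x - -29274 ≠ 0 := sub_ne_zero.mpr hx₁
  have hx₂' : x - 0 ≠ 0 := sub_ne_zero.mpr hx₂
  ext i
  fin_cases i
  · show charFst hsplit (parityHom 2) (.some x y hP) = parityBit 2 (x - -29274)
    rw [charFst_apply, twoDescentComponent_some_of_ne hP hx₁, parityHom_sqClass hx₁']
  · show charFst hsplit (parityHom 3) (.some x y hP) = parityBit 3 (x - -29274)
    rw [charFst_apply, twoDescentComponent_some_of_ne hP hx₁, parityHom_sqClass hx₁']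
  · show charFst hsplit (parityHom 7) (.some x y hP) = parityBit 7 (x - -29274)
    rw [charFst_apply, twoDescentComponent_some_of_ne hP hx₁, parityHom_sqClass hx₁']
  · show charFst hsplit (parityHom 17) (.some x y hP) = parityBit 17 (x - -29274)
    rw [charFst_apply, twoDescentComponent_some_of_ne hP hx₁, parityHom_sqClass hx₁']
  · show charFst hsplit (parityHom 41) (.some x y hP) = parityBit 41 (x - -29274)
    rw [charFst_apply, twoDescentComponent_some_of_ne hP hx₁, parityHom_sqClass hx₁']
  · show charSnd hsplit signHom (.some x y hP) = signBit (x - 0)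
    rw [charSnd_apply, twoDescentComponent_some_of_ne hP hx₂, signHom_sqClass hx₂']
  · show charSnd hsplit (parityHom 2) (.some x y hP) = parityBit 2 (x - 0)
    rw [charSnd_apply, twoDescentComponent_some_of_ne hP hx₂, parityHom_sqClass hx₂']
  · show charSnd hsplit (parityHom 3) (.some x y hP) = parityBit 3 (x - 0)
    rw [charSnd_apply, twoDescentComponent_some_of_ne hP hx₂, parityHom_sqClass hx₂']
  · show charSnd hsplit (parityHom 7) (.some x y hP) = parityBit 7 (x - 0)
    rw [charSnd_apply, twoDescentComponent_some_of_ne hP hx₂, parityHom_sqClass hx₂']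
  · show charSnd hsplit (parityHom 17) (.some x y hP) = parityBit 17 (x - 0)
    rw [charSnd_apply, twoDescentComponent_some_of_ne hP hx₂, parityHom_sqClass hx₂']
  · show charSnd hsplit (parityHom 41) (.some x y hP) = parityBit 41 (x - 0)
    rw [charSnd_apply, twoDescentComponent_some_of_ne hP hx₂, parityHom_sqClass hx₂']

/-- `φ(T₁)` for `T₁ = (-29274, 0)`: `δ(T₁) = (2·29274², -29274)`. [folklore] -/
private theorem φ_T1 :
    φ (.some _ _ (nonsingular_twoTorsion hsplit)) = ![1, 0, 0, 0, 0, 1, 1, 1, 1, 1, 1] := by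
  have h₁ : (((-29274 : ℚ) - 0) * ((-29274 : ℚ) - 29274)) ≠ 0 := by norm_num
  have h₂ : ((-29274 : ℚ) - 0) ≠ 0 := by norm_num
  ext i
  fin_cases i
  · show charFst hsplit (parityHom 2) _ = 1
    rw [charFst_apply, twoDescentComponent_some_of_eq _ rfl, parityHom_sqClass h₁]
    exact parityBit_eq_of_eq 2 3 (u := 214241769) (v := 1) (1) (Or.inl rfl) (by norm_num)
      (by norm_num) (by norm_num)
  · show charFst hsplit (parityHom 3) _ = 0
    rw [charFst_apply, twoDescentComponent_some_of_eq _ rfl, parityHom_sqClass h₁]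
    exact parityBit_eq_of_eq 3 2 (u := 190437128) (v := 1) (1) (Or.inl rfl) (by norm_num)
      (by norm_num) (by norm_num)
  · show charFst hsplit (parityHom 7) _ = 0
    rw [charFst_apply, twoDescentComponent_some_of_eq _ rfl, parityHom_sqClass h₁]
    exact parityBit_eq_of_eq 7 2 (u := 34978248) (v := 1) (1) (Or.inl rfl) (by norm_num)
      (by norm_num) (by norm_num)
  · show charFst hsplit (parityHom 17) _ = 0
    rw [charFst_apply, twoDescentComponent_some_of_eq _ rfl, parityHom_sqClass h₁]
    exact parityBit_eq_of_eq 17 2 (u := 5930568) (v := 1) (1) (Or.inl rfl) (by norm_num)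
      (by norm_num) (by norm_num)
  · show charFst hsplit (parityHom 41) _ = 0
    rw [charFst_apply, twoDescentComponent_some_of_eq _ rfl, parityHom_sqClass h₁]
    exact parityBit_eq_of_eq 41 2 (u := 1019592) (v := 1) (1) (Or.inl rfl) (by norm_num)
      (by norm_num) (by norm_num)
  · show charSnd hsplit signHom _ = 1
    rw [charSnd_apply, twoDescentComponent_some_of_ne _ (by norm_num), signHom_sqClass h₂]
    exact signBit_of_neg (by norm_num)
  · show charSnd hsplit (parityHom 2) _ = 1
    rw [charSnd_apply, twoDescentComponent_some_of_ne _ (by norm_num), parityHom_sqClass h₂]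
    exact parityBit_eq_of_eq 2 1 (u := 14637) (v := 1) (-1) (Or.inr rfl) (by norm_num)
      (by norm_num) (by norm_num)
  · show charSnd hsplit (parityHom 3) _ = 1
    rw [charSnd_apply, twoDescentComponent_some_of_ne _ (by norm_num), parityHom_sqClass h₂]
    exact parityBit_eq_of_eq 3 1 (u := 9758) (v := 1) (-1) (Or.inr rfl) (by norm_num)
      (by norm_num) (by norm_num)
  · show charSnd hsplit (parityHom 7) _ = 1
    rw [charSnd_apply, twoDescentComponent_some_of_ne _ (by norm_num), parityHom_sqClass h₂]
    exact parityBit_eq_of_eq 7 1 (u := 4182) (v := 1) (-1) (Or.inr rfl) (by norm_num)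
      (by norm_num) (by norm_num)
  · show charSnd hsplit (parityHom 17) _ = 1
    rw [charSnd_apply, twoDescentComponent_some_of_ne _ (by norm_num), parityHom_sqClass h₂]
    exact parityBit_eq_of_eq 17 1 (u := 1722) (v := 1) (-1) (Or.inr rfl) (by norm_num)
      (by norm_num) (by norm_num)
  · show charSnd hsplit (parityHom 41) _ = 1
    rw [charSnd_apply, twoDescentComponent_some_of_ne _ (by norm_num), parityHom_sqClass h₂]
    exact parityBit_eq_of_eq 41 1 (u := 714) (v := 1) (-1) (Or.inr rfl) (by norm_num)
      (by norm_num) (by norm_num)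

/-- `φ(T₂)` for `T₂ = (0, 0)`: `δ(T₂) = (29274, -29274²)`. [folklore] -/
private theorem φ_T2 :
    φ (.some _ _ (nonsingular_twoTorsion hsplit.swap₁₂)) = ![1, 1, 1, 1, 1, 1, 0, 0, 0, 0, 0] := by
  have h₁ : ((0 : ℚ) - -29274) ≠ 0 := by norm_num
  have h₂ : (((0 : ℚ) - -29274) * ((0 : ℚ) - 29274)) ≠ 0 := by norm_num
  ext i
  fin_cases i
  · show charFst hsplit (parityHom 2) _ = 1
    rw [charFst_apply, twoDescentComponent_some_of_ne _ (by norm_num), parityHom_sqClass h₁]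
    exact parityBit_eq_of_eq 2 1 (u := 14637) (v := 1) (1) (Or.inl rfl) (by norm_num)
      (by norm_num) (by norm_num)
  · show charFst hsplit (parityHom 3) _ = 1
    rw [charFst_apply, twoDescentComponent_some_of_ne _ (by norm_num), parityHom_sqClass h₁]
    exact parityBit_eq_of_eq 3 1 (u := 9758) (v := 1) (1) (Or.inl rfl) (by norm_num)
      (by norm_num) (by norm_num)
  · show charFst hsplit (parityHom 7) _ = 1
    rw [charFst_apply, twoDescentComponent_some_of_ne _ (by norm_num), parityHom_sqClass h₁]
    exact parityBit_eq_of_eq 7 1 (u := 4182) (v := 1) (1) (Or.inl rfl) (by norm_num)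
      (by norm_num) (by norm_num)
  · show charFst hsplit (parityHom 17) _ = 1
    rw [charFst_apply, twoDescentComponent_some_of_ne _ (by norm_num), parityHom_sqClass h₁]
    exact parityBit_eq_of_eq 17 1 (u := 1722) (v := 1) (1) (Or.inl rfl) (by norm_num)
      (by norm_num) (by norm_num)
  · show charFst hsplit (parityHom 41) _ = 1
    rw [charFst_apply, twoDescentComponent_some_of_ne _ (by norm_num), parityHom_sqClass h₁]
    exact parityBit_eq_of_eq 41 1 (u := 714) (v := 1) (1) (Or.inl rfl) (by norm_num)
      (by norm_num) (by norm_num)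
  · show charSnd hsplit signHom _ = 1
    rw [charSnd_apply, twoDescentComponent_some_of_eq _ rfl, signHom_sqClass h₂]
    exact signBit_of_neg (by norm_num)
  · show charSnd hsplit (parityHom 2) _ = 0
    rw [charSnd_apply, twoDescentComponent_some_of_eq _ rfl, parityHom_sqClass h₂]
    exact parityBit_eq_of_eq 2 2 (u := 214241769) (v := 1) (-1) (Or.inr rfl) (by norm_num)
      (by norm_num) (by norm_num)
  · show charSnd hsplit (parityHom 3) _ = 0
    rw [charSnd_apply, twoDescentComponent_some_of_eq _ rfl, parityHom_sqClass h₂]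
    exact parityBit_eq_of_eq 3 2 (u := 95218564) (v := 1) (-1) (Or.inr rfl) (by norm_num)
      (by norm_num) (by norm_num)
  · show charSnd hsplit (parityHom 7) _ = 0
    rw [charSnd_apply, twoDescentComponent_some_of_eq _ rfl, parityHom_sqClass h₂]
    exact parityBit_eq_of_eq 7 2 (u := 17489124) (v := 1) (-1) (Or.inr rfl) (by norm_num)
      (by norm_num) (by norm_num)
  · show charSnd hsplit (parityHom 17) _ = 0
    rw [charSnd_apply, twoDescentComponent_some_of_eq _ rfl, parityHom_sqClass h₂]
    exact parityBit_eq_of_eq 17 2 (u := 2965284) (v := 1) (-1) (Or.inr rfl) (by norm_num)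
      (by norm_num) (by norm_num)
  · show charSnd hsplit (parityHom 41) _ = 0
    rw [charSnd_apply, twoDescentComponent_some_of_eq _ rfl, parityHom_sqClass h₂]
    exact parityBit_eq_of_eq 41 2 (u := 509796) (v := 1) (-1) (Or.inr rfl) (by norm_num)
      (by norm_num) (by norm_num)

/-- `φ(T₃)` for `T₃ = (29274, 0)`: `δ(T₃) = (2·29274, 29274)`. [folklore] -/
private theorem φ_T3 :
    φ (.some _ _ (nonsingular_twoTorsion hsplit.swap₂₃.swap₁₂)) =
      ![0, 1, 1, 1, 1, 0, 1, 1, 1, 1, 1] := by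
  have h₁ : ((29274 : ℚ) - -29274) ≠ 0 := by norm_num
  have h₂ : ((29274 : ℚ) - 0) ≠ 0 := by norm_num
  ext i
  fin_cases i
  · show charFst hsplit (parityHom 2) _ = 0
    rw [charFst_apply, twoDescentComponent_some_of_ne _ (by norm_num), parityHom_sqClass h₁]
    exact parityBit_eq_of_eq 2 2 (u := 14637) (v := 1) (1) (Or.inl rfl) (by norm_num)
      (by norm_num) (by norm_num)
  · show charFst hsplit (parityHom 3) _ = 1
    rw [charFst_apply, twoDescentComponent_some_of_ne _ (by norm_num), parityHom_sqClass h₁]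
    exact parityBit_eq_of_eq 3 1 (u := 19516) (v := 1) (1) (Or.inl rfl) (by norm_num)
      (by norm_num) (by norm_num)
  · show charFst hsplit (parityHom 7) _ = 1
    rw [charFst_apply, twoDescentComponent_some_of_ne _ (by norm_num), parityHom_sqClass h₁]
    exact parityBit_eq_of_eq 7 1 (u := 8364) (v := 1) (1) (Or.inl rfl) (by norm_num)
      (by norm_num) (by norm_num)
  · show charFst hsplit (parityHom 17) _ = 1
    rw [charFst_apply, twoDescentComponent_some_of_ne _ (by norm_num), parityHom_sqClass h₁]
    exact parityBit_eq_of_eq 17 1 (u := 3444) (v := 1) (1) (Or.inl rfl) (by norm_num)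
      (by norm_num) (by norm_num)
  · show charFst hsplit (parityHom 41) _ = 1
    rw [charFst_apply, twoDescentComponent_some_of_ne _ (by norm_num), parityHom_sqClass h₁]
    exact parityBit_eq_of_eq 41 1 (u := 1428) (v := 1) (1) (Or.inl rfl) (by norm_num)
      (by norm_num) (by norm_num)
  · show charSnd hsplit signHom _ = 0
    rw [charSnd_apply, twoDescentComponent_some_of_ne _ (by norm_num), signHom_sqClass h₂]
    exact signBit_of_nonneg (by norm_num)
  · show charSnd hsplit (parityHom 2) _ = 1
    rw [charSnd_apply, twoDescentComponent_some_of_ne _ (by norm_num), parityHom_sqClass h₂]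
    exact parityBit_eq_of_eq 2 1 (u := 14637) (v := 1) (1) (Or.inl rfl) (by norm_num)
      (by norm_num) (by norm_num)
  · show charSnd hsplit (parityHom 3) _ = 1
    rw [charSnd_apply, twoDescentComponent_some_of_ne _ (by norm_num), parityHom_sqClass h₂]
    exact parityBit_eq_of_eq 3 1 (u := 9758) (v := 1) (1) (Or.inl rfl) (by norm_num)
      (by norm_num) (by norm_num)
  · show charSnd hsplit (parityHom 7) _ = 1
    rw [charSnd_apply, twoDescentComponent_some_of_ne _ (by norm_num), parityHom_sqClass h₂]
    exact parityBit_eq_of_eq 7 1 (u := 4182) (v := 1) (1) (Or.inl rfl) (by norm_num)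
      (by norm_num) (by norm_num)
  · show charSnd hsplit (parityHom 17) _ = 1
    rw [charSnd_apply, twoDescentComponent_some_of_ne _ (by norm_num), parityHom_sqClass h₂]
    exact parityBit_eq_of_eq 17 1 (u := 1722) (v := 1) (1) (Or.inl rfl) (by norm_num)
      (by norm_num) (by norm_num)
  · show charSnd hsplit (parityHom 41) _ = 1
    rw [charSnd_apply, twoDescentComponent_some_of_ne _ (by norm_num), parityHom_sqClass h₂]
    exact parityBit_eq_of_eq 41 1 (u := 714) (v := 1) (1) (Or.inl rfl) (by norm_num)
      (by norm_num) (by norm_num)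

/-- The matrix of the `5` independent linear local conditions (two at `3`, two at `7`, one at
`17`) in the coordinates `(v₂, v₃, v₇, v₁₇, v₄₁)(x + n); (sign, v₂, v₃, v₇, v₁₇, v₄₁)(x)`. [folklore] -/
def M : Matrix (Fin 5) (Fin 11) (ZMod 2) :=
  !![0, 1, 0, 0, 0, 1, 1, 0, 0, 1, 1;
     1, 0, 0, 1, 1, 1, 1, 1, 0, 1, 1;
     0, 0, 1, 0, 0, 1, 0, 1, 0, 1, 1;
     0, 1, 0, 1, 1, 1, 0, 1, 0, 1, 1;
     0, 0, 0, 0, 0, 0, 0, 1, 1, 1, 1]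

/-- `κ = M ·` as an additive map. [folklore] -/
def κ : (Fin 11 → ZMod 2) →+ (Fin 5 → ZMod 2) := (Matrix.mulVecLin M).toAddMonoidHom

set_option synthInstance.maxSize 100000 in
set_option synthInstance.maxHeartbeats 400000 in
/-- `κ` is onto (explicit preimages of the basis vectors). [folklore] -/
private theorem κ_surjective : Function.Surjective κ := by
  intro w
  refine ⟨![0, 0, 0, 0, w 2 + w 3, 0, w 1 + w 3, w 0 + w 1 + w 2 + w 3, w 2 + w 4, 0,
    w 0 + w 1 + w 3], ?_⟩
  revert w
  decide

set_option synthInstance.maxSize 100000 in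
set_option synthInstance.maxHeartbeats 400000 in
/-- `κ` vanishes on vectors satisfying the `5` conditions. [folklore] -/
private theorem κ_eq_zero_of_rows (a2 a3 a7 a17 a41 s b2 b3 b7 b17 b41 : ZMod 2)
    (r0 : a3 + s + b2 + b17 + b41 = 0)
    (r1 : a2 + a17 + a41 + s + b2 + b3 + b17 + b41 = 0)
    (r2 : a7 + s + b3 + b17 + b41 = 0)
    (r3 : a3 + a17 + a41 + s + b3 + b17 + b41 = 0)
    (r4 : b3 + b7 + b17 + b41 = 0) :
    κ ![a2, a3, a7, a17, a41, s, b2, b3, b7, b17, b41] = 0 := by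
  revert r0 r1 r2 r3 r4 a2 a3 a7 a17 a41 s b2 b3 b7 b17 b41
  decide

set_option synthInstance.maxSize 100000 in
set_option synthInstance.maxHeartbeats 400000 in
/-- The local condition at `p = 3` (type `I₀*`) in coordinates: with `(q/3) = -1` for
`q = -1, 2, 17, 41` and `(7/3) = +1`, the four cases of `local_condition_I0` force the two
functionals `a3 + s + b2 + b17 + b41` and `a2 + a17 + a41 + s + b2 + b3 + b17 + b41`
(abstract form, by enumeration). [folklore] -/
private theorem rows_3 (a2 a3 a7 a17 a41 s b2 b3 b7 b17 b41 qa qb : ZMod 2)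
    (H : (a3 = 0 ∧ qa = 0 ∧ b3 = 0 ∧ qb = 0) ∨ (a3 = 0 ∧ qa = 1 ∧ b3 = 1 ∧ qb = 0) ∨
      (a3 = 1 ∧ qa = 1 ∧ b3 = 0 ∧ qb = 1) ∨ (a3 = 1 ∧ qa = 0 ∧ b3 = 1 ∧ qb = 1))
    (hqa : qa = a2 * 1 + (a7 * 0 + (a17 * 1 + (a41 * 1 + 0))))
    (hqb : qb = s * 1 + (b2 * 1 + (b7 * 0 + (b17 * 1 + (b41 * 1 + 0))))) :
    a3 + s + b2 + b17 + b41 = 0 ∧ a2 + a17 + a41 + s + b2 + b3 + b17 + b41 = 0 := by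
  subst hqa hqb
  revert H a2 a3 a7 a17 a41 s b2 b3 b7 b17 b41
  decide

set_option synthInstance.maxSize 100000 in
set_option synthInstance.maxHeartbeats 400000 in
/-- The local condition at `p = 7` in coordinates: `(q/7) = -1` for `q = -1, 3, 17, 41`,
`(2/7) = +1`; forced functionals `a7 + s + b3 + b17 + b41` and
`a3 + a17 + a41 + s + b3 + b17 + b41`. [folklore] -/
private theorem rows_7 (a2 a3 a7 a17 a41 s b2 b3 b7 b17 b41 qa qb : ZMod 2)
    (H : (a7 = 0 ∧ qa = 0 ∧ b7 = 0 ∧ qb = 0) ∨ (a7 = 0 ∧ qa = 0 ∧ b7 = 1 ∧ qb = 0) ∨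
      (a7 = 1 ∧ qa = 1 ∧ b7 = 0 ∧ qb = 1) ∨ (a7 = 1 ∧ qa = 1 ∧ b7 = 1 ∧ qb = 1))
    (hqa : qa = a2 * 0 + (a3 * 1 + (a17 * 1 + (a41 * 1 + 0))))
    (hqb : qb = s * 1 + (b2 * 0 + (b3 * 1 + (b17 * 1 + (b41 * 1 + 0))))) :
    a7 + s + b3 + b17 + b41 = 0 ∧ a3 + a17 + a41 + s + b3 + b17 + b41 = 0 := by
  subst hqa hqb
  revert H a2 a3 a7 a17 a41 s b2 b3 b7 b17 b41
  decide

set_option synthInstance.maxSize 100000 in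
set_option synthInstance.maxHeartbeats 400000 in
/-- The local condition at `p = 17` in coordinates: `(q/17) = +1` for `q = -1, 2` and `-1` for
`q = 3, 7, 41`; forced functional (second component) `b3 + b7 + b17 + b41`. [folklore] -/
private theorem rows_17 (a2 a3 a7 a17 a41 s b2 b3 b7 b17 b41 qa qb : ZMod 2)
    (H : (a17 = 0 ∧ qa = 0 ∧ b17 = 0 ∧ qb = 0) ∨ (a17 = 0 ∧ qa = 0 ∧ b17 = 1 ∧ qb = 1) ∨
      (a17 = 1 ∧ qa = 1 ∧ b17 = 0 ∧ qb = 0) ∨ (a17 = 1 ∧ qa = 1 ∧ b17 = 1 ∧ qb = 1))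
    (hqa : qa = a2 * 0 + (a3 * 1 + (a7 * 1 + (a41 * 1 + 0))))
    (hqb : qb = s * 0 + (b2 * 0 + (b3 * 1 + (b7 * 1 + (b41 * 1 + 0))))) :
    b3 + b7 + b17 + b41 = 0 := by
  subst hqa hqb
  revert H a2 a3 a7 a17 a41 s b2 b3 b7 b17 b41
  decide

/-- **The local conditions hold on `E₂₉₂₇₄(ℚ)`**: `κ ∘ φ = 0`. For the `2`-torsion by
evaluation; for `(x, y)` with `y ≠ 0` from `local_condition_I0` at `3`, `7`, `17` (all of type
`I₀*`: `v_p(eᵢ - eⱼ) = 1`) with the quadratic-residue bits of `x + n` and `x` expanded along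
sign and parities (`qrBit_eq_signBit_add_listSum`). [cite: SilvermanAEC2009, Prop. X.1.4] -/
private theorem kill (P : (E).toAffine.Point) : κ (φ P) = 0 := by
  rcases point_cases hsplit P with rfl | rfl | rfl | rfl |
      ⟨x, y, hP, rfl, hx₁, hx₂, -, hy, hsq⟩
  · rw [_root_.map_zero, _root_.map_zero]
  · rw [φ_T1]; decide
  · rw [φ_T2]; decide
  · rw [φ_T3]; decide
  · simp only [cn_affine_a₁, cn_affine_a₃, zero_mul, add_zero, zero_div] at hy hsq
    rw [φ_some hP hx₁ hx₂]
    obtain ⟨hd₁, hd₂, -⟩ := sub_ne_zero_of_sq_eq hsq hy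
    have hsgn := signBit_sub_of_lt_of_lt hsq hy (by norm_num) (by norm_num)
    have hev₁ : ∀ q : ℕ, q.Prime → q ∉ ([2, 3, 7, 17, 41] : List ℕ) →
        Even (padicValRat q (x - -29274)) := by
      intro q hq hql
      haveI : Fact q.Prime := ⟨hq⟩
      refine Curve24A1.even_padicValRat_sub q (by norm_num) (by norm_num) ?_ ?_ hy hsq
      · rw [show (-29274 : ℚ) - 0 = ((-29274 : ℤ) : ℚ) by norm_num]
        exact padicValRat_eq_zero_of_eq_prod hq [2, 3, 7, 17, 41] (by norm_num)
          (fun h => hql (by simp at h ⊢; omega)) (by norm_num)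
      · rw [show (-29274 : ℚ) - 29274 = ((-58548 : ℤ) : ℚ) by norm_num]
        exact padicValRat_eq_zero_of_eq_prod hq [2, 2, 3, 7, 17, 41] (by norm_num)
          (fun h => hql (by simp at h ⊢; omega)) (by norm_num)
    have hev₂ : ∀ q : ℕ, q.Prime → q ∉ ([2, 3, 7, 17, 41] : List ℕ) →
        Even (padicValRat q (x - 0)) := by
      intro q hq hql
      haveI : Fact q.Prime := ⟨hq⟩
      refine Curve24A1.even_padicValRat_sub q (by norm_num) (by norm_num) ?_ ?_ hy
        (show y ^ 2 = (x - 0) * (x - -29274) * (x - 29274) by rw [hsq]; ring)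
      · rw [show (0 : ℚ) - -29274 = ((29274 : ℤ) : ℚ) by norm_num]
        exact padicValRat_eq_zero_of_eq_prod hq [2, 3, 7, 17, 41] (by norm_num)
          (fun h => hql (by simp at h ⊢; omega)) (by norm_num)
      · rw [show (0 : ℚ) - 29274 = ((-29274 : ℤ) : ℚ) by norm_num]
        exact padicValRat_eq_zero_of_eq_prod hq [2, 3, 7, 17, 41] (by norm_num)
          (fun h => hql (by simp at h ⊢; omega)) (by norm_num)
    -- p = 3
    have H3 := local_condition_I0 (p := 3) hsq hy
      (padicValRat_eq_of_eq (p := 3) 1 (u := 9758) (v := 1) (-1) (Or.inr rfl) (by norm_num)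
        (by norm_num) (by norm_num))
      (padicValRat_eq_of_eq (p := 3) 1 (u := 19516) (v := 1) (-1) (Or.inr rfl) (by norm_num)
        (by norm_num) (by norm_num))
      (padicValRat_eq_of_eq (p := 3) 1 (u := 9758) (v := 1) (-1) (Or.inr rfl) (by norm_num)
        (by norm_num) (by norm_num))
    have B3₁ := qrBit_eq_signBit_add_listSum (p := 3) hd₁ [2, 7, 17, 41] (by decide)
      (by norm_num) (by decide) (fun q hq hql hqp => hev₁ q hq (by simp at hql ⊢; omega))
    have B3₂ := qrBit_eq_signBit_add_listSum (p := 3) hd₂ [2, 7, 17, 41] (by decide)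
      (by norm_num) (by decide) (fun q hq hql hqp => hev₂ q hq (by simp at hql ⊢; omega))
    simp only [List.map_cons, List.map_nil, List.sum_cons, List.sum_nil] at B3₁ B3₂
    have c3_0 : qrBit 3 (((-29274 : ℚ) - 0) * (-29274 - 29274)) = 1 :=
      qrBit_eq_one_of_eq (p := 3) 2 (190437128) (by norm_num) (by norm_num)
    have c3_1 : qrBit 3 ((-29274 : ℚ) - 0) = 0 :=
      qrBit_eq_zero_of_eq (p := 3) 1 (-9758) (by norm_num) (by norm_num)
    have c3_2 : qrBit 3 ((0 : ℚ) - -29274) = 1 :=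
      qrBit_eq_one_of_eq (p := 3) 1 (9758) (by norm_num) (by norm_num)
    have c3_3 : qrBit 3 (((0 : ℚ) - -29274) * (0 - 29274)) = 1 :=
      qrBit_eq_one_of_eq (p := 3) 2 (-95218564) (by norm_num) (by norm_num)
    have c3_4 : qrBit 3 ((29274 : ℚ) - -29274) = 0 :=
      qrBit_eq_zero_of_eq (p := 3) 1 (19516) (by norm_num) (by norm_num)
    have c3_5 : qrBit 3 ((29274 : ℚ) - 0) = 1 :=
      qrBit_eq_one_of_eq (p := 3) 1 (9758) (by norm_num) (by norm_num)
    have c3_6 : qrBit 3 ((-1 : ℚ)) = 1 := qrBit_eq_one_of_eq (p := 3) 0 (-1) (by norm_num) (by norm_num)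
    have c3_7 : qrBit 3 (((2 : ℕ) : ℚ)) = 1 := qrBit_eq_one_of_eq (p := 3) 0 (2) (by norm_num) (by norm_num)
    have c3_8 : qrBit 3 (((7 : ℕ) : ℚ)) = 0 := qrBit_eq_zero_of_eq (p := 3) 0 (7) (by norm_num) (by norm_num)
    have c3_9 : qrBit 3 (((17 : ℕ) : ℚ)) = 1 := qrBit_eq_one_of_eq (p := 3) 0 (17) (by norm_num) (by norm_num)
    have c3_10 : qrBit 3 (((41 : ℕ) : ℚ)) = 1 := qrBit_eq_one_of_eq (p := 3) 0 (41) (by norm_num) (by norm_num)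
    rw [c3_0, c3_1, c3_2, c3_3, c3_4, c3_5] at H3
    rw [hsgn.1, zero_mul, zero_add, c3_7, c3_8, c3_9, c3_10] at B3₁
    rw [c3_6, c3_7, c3_8, c3_9, c3_10] at B3₂
    have R3 := rows_3 (parityBit 2 (x - -29274)) (parityBit 3 (x - -29274))
      (parityBit 7 (x - -29274)) (parityBit 17 (x - -29274)) (parityBit 41 (x - -29274))
      (signBit (x - 0)) (parityBit 2 (x - 0)) (parityBit 3 (x - 0)) (parityBit 7 (x - 0))
      (parityBit 17 (x - 0)) (parityBit 41 (x - 0)) _ _ H3 B3₁ B3₂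
    -- p = 7
    have H7 := local_condition_I0 (p := 7) hsq hy
      (padicValRat_eq_of_eq (p := 7) 1 (u := 4182) (v := 1) (-1) (Or.inr rfl) (by norm_num)
        (by norm_num) (by norm_num))
      (padicValRat_eq_of_eq (p := 7) 1 (u := 8364) (v := 1) (-1) (Or.inr rfl) (by norm_num)
        (by norm_num) (by norm_num))
      (padicValRat_eq_of_eq (p := 7) 1 (u := 4182) (v := 1) (-1) (Or.inr rfl) (by norm_num)
        (by norm_num) (by norm_num))
    have B7₁ := qrBit_eq_signBit_add_listSum (p := 7) hd₁ [2, 3, 17, 41] (by decide)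
      (by norm_num) (by decide) (fun q hq hql hqp => hev₁ q hq (by simp at hql ⊢; omega))
    have B7₂ := qrBit_eq_signBit_add_listSum (p := 7) hd₂ [2, 3, 17, 41] (by decide)
      (by norm_num) (by decide) (fun q hq hql hqp => hev₂ q hq (by simp at hql ⊢; omega))
    simp only [List.map_cons, List.map_nil, List.sum_cons, List.sum_nil] at B7₁ B7₂
    have c7_0 : qrBit 7 (((-29274 : ℚ) - 0) * (-29274 - 29274)) = 0 :=
      qrBit_eq_zero_of_eq (p := 7) 2 (34978248) (by norm_num) (by norm_num)
    have c7_1 : qrBit 7 ((-29274 : ℚ) - 0) = 0 :=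
      qrBit_eq_zero_of_eq (p := 7) 1 (-4182) (by norm_num) (by norm_num)
    have c7_2 : qrBit 7 ((0 : ℚ) - -29274) = 1 :=
      qrBit_eq_one_of_eq (p := 7) 1 (4182) (by norm_num) (by norm_num)
    have c7_3 : qrBit 7 (((0 : ℚ) - -29274) * (0 - 29274)) = 1 :=
      qrBit_eq_one_of_eq (p := 7) 2 (-17489124) (by norm_num) (by norm_num)
    have c7_4 : qrBit 7 ((29274 : ℚ) - -29274) = 1 :=
      qrBit_eq_one_of_eq (p := 7) 1 (8364) (by norm_num) (by norm_num)
    have c7_5 : qrBit 7 ((29274 : ℚ) - 0) = 1 :=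
      qrBit_eq_one_of_eq (p := 7) 1 (4182) (by norm_num) (by norm_num)
    have c7_6 : qrBit 7 ((-1 : ℚ)) = 1 := qrBit_eq_one_of_eq (p := 7) 0 (-1) (by norm_num) (by norm_num)
    have c7_7 : qrBit 7 (((2 : ℕ) : ℚ)) = 0 := qrBit_eq_zero_of_eq (p := 7) 0 (2) (by norm_num) (by norm_num)
    have c7_8 : qrBit 7 (((3 : ℕ) : ℚ)) = 1 := qrBit_eq_one_of_eq (p := 7) 0 (3) (by norm_num) (by norm_num)
    have c7_9 : qrBit 7 (((17 : ℕ) : ℚ)) = 1 := qrBit_eq_one_of_eq (p := 7) 0 (17) (by norm_num) (by norm_num)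
    have c7_10 : qrBit 7 (((41 : ℕ) : ℚ)) = 1 := qrBit_eq_one_of_eq (p := 7) 0 (41) (by norm_num) (by norm_num)
    rw [c7_0, c7_1, c7_2, c7_3, c7_4, c7_5] at H7
    rw [hsgn.1, zero_mul, zero_add, c7_7, c7_8, c7_9, c7_10] at B7₁
    rw [c7_6, c7_7, c7_8, c7_9, c7_10] at B7₂
    have R7 := rows_7 (parityBit 2 (x - -29274)) (parityBit 3 (x - -29274))
      (parityBit 7 (x - -29274)) (parityBit 17 (x - -29274)) (parityBit 41 (x - -29274))
      (signBit (x - 0)) (parityBit 2 (x - 0)) (parityBit 3 (x - 0)) (parityBit 7 (x - 0))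
      (parityBit 17 (x - 0)) (parityBit 41 (x - 0)) _ _ H7 B7₁ B7₂
    -- p = 17
    have H17 := local_condition_I0 (p := 17) hsq hy
      (padicValRat_eq_of_eq (p := 17) 1 (u := 1722) (v := 1) (-1) (Or.inr rfl) (by norm_num)
        (by norm_num) (by norm_num))
      (padicValRat_eq_of_eq (p := 17) 1 (u := 3444) (v := 1) (-1) (Or.inr rfl) (by norm_num)
        (by norm_num) (by norm_num))
      (padicValRat_eq_of_eq (p := 17) 1 (u := 1722) (v := 1) (-1) (Or.inr rfl) (by norm_num)
        (by norm_num) (by norm_num))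
    have B17₁ := qrBit_eq_signBit_add_listSum (p := 17) hd₁ [2, 3, 7, 41] (by decide)
      (by norm_num) (by decide) (fun q hq hql hqp => hev₁ q hq (by simp at hql ⊢; omega))
    have B17₂ := qrBit_eq_signBit_add_listSum (p := 17) hd₂ [2, 3, 7, 41] (by decide)
      (by norm_num) (by decide) (fun q hq hql hqp => hev₂ q hq (by simp at hql ⊢; omega))
    simp only [List.map_cons, List.map_nil, List.sum_cons, List.sum_nil] at B17₁ B17₂
    have c17_0 : qrBit 17 (((-29274 : ℚ) - 0) * (-29274 - 29274)) = 0 :=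
      qrBit_eq_zero_of_eq (p := 17) 2 (5930568) (by norm_num) (by norm_num)
    have c17_1 : qrBit 17 ((-29274 : ℚ) - 0) = 1 :=
      qrBit_eq_one_of_eq (p := 17) 1 (-1722) (by norm_num) (by norm_num)
    have c17_2 : qrBit 17 ((0 : ℚ) - -29274) = 1 :=
      qrBit_eq_one_of_eq (p := 17) 1 (1722) (by norm_num) (by norm_num)
    have c17_3 : qrBit 17 (((0 : ℚ) - -29274) * (0 - 29274)) = 0 :=
      qrBit_eq_zero_of_eq (p := 17) 2 (-2965284) (by norm_num) (by norm_num)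
    have c17_4 : qrBit 17 ((29274 : ℚ) - -29274) = 1 :=
      qrBit_eq_one_of_eq (p := 17) 1 (3444) (by norm_num) (by norm_num)
    have c17_5 : qrBit 17 ((29274 : ℚ) - 0) = 1 :=
      qrBit_eq_one_of_eq (p := 17) 1 (1722) (by norm_num) (by norm_num)
    have c17_6 : qrBit 17 ((-1 : ℚ)) = 0 := qrBit_eq_zero_of_eq (p := 17) 0 (-1) (by norm_num) (by norm_num)
    have c17_7 : qrBit 17 (((2 : ℕ) : ℚ)) = 0 := qrBit_eq_zero_of_eq (p := 17) 0 (2) (by norm_num) (by norm_num)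
    have c17_8 : qrBit 17 (((3 : ℕ) : ℚ)) = 1 := qrBit_eq_one_of_eq (p := 17) 0 (3) (by norm_num) (by norm_num)
    have c17_9 : qrBit 17 (((7 : ℕ) : ℚ)) = 1 := qrBit_eq_one_of_eq (p := 17) 0 (7) (by norm_num) (by norm_num)
    have c17_10 : qrBit 17 (((41 : ℕ) : ℚ)) = 1 := qrBit_eq_one_of_eq (p := 17) 0 (41) (by norm_num) (by norm_num)
    rw [c17_0, c17_1, c17_2, c17_3, c17_4, c17_5] at H17
    rw [hsgn.1, zero_mul, zero_add, c17_7, c17_8, c17_9, c17_10] at B17₁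
    rw [c17_6, c17_7, c17_8, c17_9, c17_10] at B17₂
    have R17 := rows_17 (parityBit 2 (x - -29274)) (parityBit 3 (x - -29274))
      (parityBit 7 (x - -29274)) (parityBit 17 (x - -29274)) (parityBit 41 (x - -29274))
      (signBit (x - 0)) (parityBit 2 (x - 0)) (parityBit 3 (x - 0)) (parityBit 7 (x - 0))
      (parityBit 17 (x - 0)) (parityBit 41 (x - 0)) _ _ H17 B17₁ B17₂
    exact κ_eq_zero_of_rows _ _ _ _ _ _ _ _ _ _ _ R3.1 R3.2 R7.1 R7.2 R17

/-- `φ` detects the `2`-descent class: `φ P = 0 ⟹ δ(P) = 0` (sign and parities at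
`2, 3, 7, 17, 41` determine the classes of `x + n > 0` and of `x` in `ℚ(S, 2)`).
[cite: SilvermanAEC2009, Prop. X.1.4] -/
private theorem hker (P : (E).toAffine.Point) (h0 : φ P = 0) : twoDescentMap hsplit P = 0 := by
  have hc : ∀ i, φ P i = 0 := fun i => by rw [h0]; rfl
  rw [twoDescentMap_apply, ofMul_eq_zero, Prod.mk_eq_one]
  constructor
  · refine twoDescentComponent_eq_one hsplit P ([2, 3, 7, 17, 41] : List ℕ).toFinset ?_
      (descentRep_pos hsplit (by norm_num) (by norm_num) P) ?_
    · intro q hq hqT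
      rw [List.mem_toFinset] at hqT
      constructor
      · rw [show (-29274 : ℚ) - 0 = ((-29274 : ℤ) : ℚ) by norm_num]
        exact padicValRat_eq_zero_of_eq_prod hq [2, 3, 7, 17, 41] (by norm_num)
          (fun h => hqT (by simp at h ⊢; omega)) (by norm_num)
      · rw [show (-29274 : ℚ) - 29274 = ((-58548 : ℤ) : ℚ) by norm_num]
        exact padicValRat_eq_zero_of_eq_prod hq [2, 2, 3, 7, 17, 41] (by norm_num)
          (fun h => hqT (by simp at h ⊢; omega)) (by norm_num)
    · intro q hq
      have hrep := twoDescentComponent_eq_sqClass (W := (E).toAffine) (e₁ := -29274) (e₂ := 0)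
        (e₃ := 29274) P
      have hne := descentRep_ne_zero hsplit P
      simp only [List.toFinset_cons, List.toFinset_nil, Finset.mem_insert, Finset.notMem_empty,
        or_false] at hq
      rcases hq with rfl | rfl | rfl | rfl | rfl
      · have h : charFst hsplit (parityHom 2) P = 0 := hc 0
        rw [charFst_apply, hrep, parityHom_sqClass hne] at h
        exact parityBit_eq_zero_iff.mp h
      · have h : charFst hsplit (parityHom 3) P = 0 := hc 1
        rw [charFst_apply, hrep, parityHom_sqClass hne] at h
        exact parityBit_eq_zero_iff.mp h
      · have h : charFst hsplit (parityHom 7) P = 0 := hc 2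
        rw [charFst_apply, hrep, parityHom_sqClass hne] at h
        exact parityBit_eq_zero_iff.mp h
      · have h : charFst hsplit (parityHom 17) P = 0 := hc 3
        rw [charFst_apply, hrep, parityHom_sqClass hne] at h
        exact parityBit_eq_zero_iff.mp h
      · have h : charFst hsplit (parityHom 41) P = 0 := hc 4
        rw [charFst_apply, hrep, parityHom_sqClass hne] at h
        exact parityBit_eq_zero_iff.mp h
  · have hrep := twoDescentComponent_eq_sqClass (W := (E).toAffine) (e₁ := 0) (e₂ := -29274)
      (e₃ := 29274) P
    have hne := descentRep_ne_zero hsplit.swap₁₂ P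
    have hs : charSnd hsplit signHom P = 0 := hc 5
    rw [charSnd_apply, hrep, signHom_sqClass hne] at hs
    refine twoDescentComponent_eq_one hsplit.swap₁₂ P ([2, 3, 7, 17, 41] : List ℕ).toFinset ?_
      (descentRep_pos_of_signBit hsplit.swap₁₂ P hs) ?_
    · intro q hq hqT
      rw [List.mem_toFinset] at hqT
      constructor
      · rw [show (0 : ℚ) - -29274 = ((29274 : ℤ) : ℚ) by norm_num]
        exact padicValRat_eq_zero_of_eq_prod hq [2, 3, 7, 17, 41] (by norm_num)
          (fun h => hqT (by simp at h ⊢; omega)) (by norm_num)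
      · rw [show (0 : ℚ) - 29274 = ((-29274 : ℤ) : ℚ) by norm_num]
        exact padicValRat_eq_zero_of_eq_prod hq [2, 3, 7, 17, 41] (by norm_num)
          (fun h => hqT (by simp at h ⊢; omega)) (by norm_num)
    · intro q hq
      simp only [List.toFinset_cons, List.toFinset_nil, Finset.mem_insert, Finset.notMem_empty,
        or_false] at hq
      rcases hq with rfl | rfl | rfl | rfl | rfl
      · have h : charSnd hsplit (parityHom 2) P = 0 := hc 6
        rw [charSnd_apply, hrep, parityHom_sqClass hne] at h
        exact parityBit_eq_zero_iff.mp h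
      · have h : charSnd hsplit (parityHom 3) P = 0 := hc 7
        rw [charSnd_apply, hrep, parityHom_sqClass hne] at h
        exact parityBit_eq_zero_iff.mp h
      · have h : charSnd hsplit (parityHom 7) P = 0 := hc 8
        rw [charSnd_apply, hrep, parityHom_sqClass hne] at h
        exact parityBit_eq_zero_iff.mp h
      · have h : charSnd hsplit (parityHom 17) P = 0 := hc 9
        rw [charSnd_apply, hrep, parityHom_sqClass hne] at h
        exact parityBit_eq_zero_iff.mp h
      · have h : charSnd hsplit (parityHom 41) P = 0 := hc 10
        rw [charSnd_apply, hrep, parityHom_sqClass hne] at h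
        exact parityBit_eq_zero_iff.mp h

end Descent

/-- **`rank_ℤ E₂₉₂₇₄(ℚ) ≤ 4`** by the complete `2`-descent over `ℚ`: the `2⁶` values of `φ`
allowed by the local conditions at `3`, `7`, `17` bound `#E(ℚ)/2E(ℚ) = 2^{r+2}`
(Silverman AEC Prop. X.1.4; `dim Sel₂(E/ℚ) = 6`). [cite: SilvermanAEC2009, Prop. X.1.4] -/
theorem mordellWeilRank_le : (E).mordellWeilRank ≤ 4 := by
  refine mordellWeilRank_le_of_linear_conditions hsplit (N := 11) (k := 5) (s := 4) rfl φ κ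
    hker kill κ_surjective ?_ ?_ ?_ ?_
  · rw [φ_T1]; decide
  · rw [φ_T2]; decide
  · rw [map_add, φ_T1, φ_T2]; decide
  · rw [φ_T1, φ_T2]; decide

/-- **`rank_ℤ E₂₉₂₇₄(ℚ) = 4` EXACTLY** (Wiman 1945; Goldfeld 1976, p. 626 «has rank `4`» [sic:
emended curve]): `4 ≤ rank` from the four independent points (`four_le_mordellWeilRank`,
companion file) and `rank ≤ 4` from the complete `2`-descent (`mordellWeilRank_le`).
[cite: SilvermanAEC2009, Prop. X.1.4] [cite: Goldfeld1976, p. 626] -/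
theorem mordellWeilRank_eq : (E).mordellWeilRank = 4 :=
  le_antisymm mordellWeilRank_le four_le_mordellWeilRank

end Literature.NumberTheory.EllipticCurves.CongruentNumber29274

end
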